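import Mathlib.MeasureTheory.Measure.Lebesgue.Basic
import Summits.QuantumFields.BalabanUV.T4Continuum.Support.ShellMeasureRootCompositionSync

/-!
# `T4Continuum.ShellMeasureRootCompositionSyncToy` — NON-VACUITY WITH A GENUINE WINDOW: the re-typed END-I
# `ShellMeasureRootCompositionSync.shellWeightBound_of_slotAC_sync` FIRES on a two-age slot family (window depth
# `N₁ = 1`, both ages populated at every level) whose thresholds VARY WITH THE AGE — a family on which END-I's
# level-indexed thresholds cannot even be written down (kernel, §2) — with live threshold shells
# (cell `pub-balaban`, sub-cell `t4`, spine estimate NE7c (node U5b); NE7c ROUND-2 crew seat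
# `b2b-balaban-t4-ne7c-formalise-leaf-09` (gen 3), companion to FINDING F-ne7cleaf09-3 ∕ `…Sync` (p211299); ADDITIVE —
# imports `ShellMeasureRootCompositionSync` and Mathlib's Lebesgue measure only; 0 `def` (the toy data are literal
# terms), 0 sorry, 0 cite)

HONEST FRAMING.  A TOY: uniform laws on `[0, 1]`, identity tested variables, thresholds `1/(a+1)` at age `a`.  It
asserts nothing about Bałaban's objects and moves no estimate; its only point is that the binder family of the
slot-indexed END-I is JOINTLY INHABITED by a family with a window of depth `1` and age-dependent thresholds (row S10's
toy `ShellMeasureRootCompositionToy` has depth `N₁ = 0`, one age), while §0 of `…Sync` forbids the level-indexed END-I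
on the same family.  NE7c = `T4IndicatorShell.ShellWeightBound` for the cell's expansions is NOT PRINTED and NOT
PROVED; «NE7c ⇐ the named binders»; spine 0/9; finite T⁴, rung (B)+1 — NOT infinite volume, NOT mass gap, NOT Clay.
HONEST DEPENDENCY (cell): continuum YM on T⁴ ⇐ BetaPertH ∧ nine spine estimates (0/9 proved); BetaPertH ⇐ (D1) ∧ (D4)
∧ CAP+tail; G-an2-4 gates asym, D1 and NE2/3/4.

THE FAMILY.  Terms: one per comparison `K` (`T K = {()}`, weight `1`).  Slots: `Fin 2` at every `K`, slot `s` at level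
`K − s` (ages `0` and `1`; at `K = 0` both at level `0`), uniform law on `[0,1]`, tested variable `x ↦ x`, threshold
BY AGE `ε (K − lvl K s)` with `ε a = 1/(a+1)`, width `ρ_j = ϑ^j/4`, constants `D ≡ 1`, `M ≡ 1`, pieces
`θ·ρ_{lvl}` (= the shell mass, push with equality), shell part of the term = the sum of its two pieces (> 0).
§1 (M1) for the uniform law at any threshold `θ ∈ [0,1]` with `D = 1`; §2 window, population, and the kernel
NON-EXPRESSIBILITY of these thresholds by one level sequence (`…Sync.ageSync_eq_of_levelIndexed`); §3 the slot-indexed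
END-I applied: `ShellWeightBound 0 T A A sh sh (K ↦ 2·Σ_s ρ_{lvl K s})`, shells live. [folklore]
-/

noncomputable section

open Set Finset MeasureTheory

namespace Summit.QuantumFields.BalabanUV.T4Continuum.ShellMeasureRootCompositionSyncToy

open scoped ENNReal
open Literature.MathematicalPhysics.QuantumFieldTheory.Balaban1983to89
open T4IndicatorShell T4ShellMeasure
open T4ShellMeasureLevels (LiveWindow)
open ShellMeasureRootCompositionSync

/-! ## §1 (M1) for the uniform law on `[0,1]` at any threshold `θ ∈ [0,1]`, constant `D = 1` -/

section Uniform
variable {θ ρ : ℝ}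

/-- the threshold shell of the identity variable at threshold `θ`, width `ρ`, is `[θ(1−ρ), θ)`. [folklore] -/
theorem shell_eq_Ico (θ ρ : ℝ) : {x : ℝ | θ * (1 - ρ) ≤ x ∧ x < θ} = Ico (θ * (1 - ρ)) θ := by
  ext x; simp

/-- under the uniform law on `[0,1]` that shell has mass `ofReal (θρ)` (`0 ≤ θ ≤ 1`, `ρ ≤ 1`; for `ρ < 0` both sides
vanish). [folklore] -/
theorem unif_shell (hθ0 : 0 ≤ θ) (hθ1 : θ ≤ 1) (hρ1 : ρ ≤ 1) :
    (volume.restrict (Icc (0 : ℝ) 1)) {x : ℝ | θ * (1 - ρ) ≤ x ∧ x < θ} = ENNReal.ofReal (θ * ρ) := by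
  have hsub : Ico (θ * (1 - ρ)) θ ⊆ Icc (0 : ℝ) 1 :=
    Ico_subset_Icc_self.trans (Icc_subset_Icc (mul_nonneg hθ0 (sub_nonneg.2 hρ1)) hθ1)
  rw [shell_eq_Ico, Measure.restrict_apply measurableSet_Ico, inter_eq_left.2 hsub, Real.volume_Ico]
  congr 1; ring

/-- the uniform law on `[0,1]` has total mass `1`. [folklore] -/
theorem unif_univ : (volume.restrict (Icc (0 : ℝ) 1)) (Set.univ : Set ℝ) = 1 := by
  rw [Measure.restrict_apply_univ, Real.volume_Icc]; simp

/-- **(M1) FOR THE UNIFORM LAW AT ANY THRESHOLD `θ ∈ [0,1]`, `D = 1`** (`0 ≤ ρ ≤ 1`):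
`μ{θ(1−ρ) ≤ x < θ} = θρ ≤ 1·ρ·μ(univ)`. [folklore] -/
theorem slotAC_unif (hθ0 : 0 ≤ θ) (hθ1 : θ ≤ 1) (hρ0 : 0 ≤ ρ) (hρ1 : ρ ≤ 1) :
    SlotAntiConcentration (volume.restrict (Icc (0 : ℝ) 1)) (fun x => x) θ ρ 1 := by
  show (volume.restrict (Icc (0 : ℝ) 1)) {x : ℝ | θ * (1 - ρ) ≤ x ∧ x < θ} ≤
    ENNReal.ofReal (1 * ρ) * (volume.restrict (Icc (0 : ℝ) 1)) (Set.univ : Set ℝ)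
  rw [unif_shell hθ0 hθ1 hρ1, unif_univ, one_mul, mul_one]
  exact ENNReal.ofReal_le_ofReal (mul_le_of_le_one_left hρ0 hθ1)

end Uniform

/-! ## §2 The two-age family: window of depth `1`, both ages populated, thresholds NOT expressible by level -/

section Family

/-- **(W1) WITH DEPTH `N₁ = 1`**: slot `s : Fin 2` of comparison `K` at level `K − s` is at most one level below the
top, and at most `2` slots share a level. [folklore] -/
theorem twoAge_liveWindow :
    LiveWindow (fun _ : ℕ => (Finset.univ : Finset (Fin 2))) (fun K (s : Fin 2) => K - (s : ℕ)) 1 2 where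
  recent K s _ := by have := s.isLt; omega
  le_top K s _ := Nat.sub_le K s
  count K j := by
    have h := (Finset.card_filter_le (Finset.univ : Finset (Fin 2)) fun s : Fin 2 => K - (s : ℕ) = j)
    rw [Finset.card_univ, Fintype.card_fin] at h
    exact_mod_cast h

/-- **BOTH AGES ARE POPULATED AT EVERY LEVEL**: level `j` carries slot `0` at comparison `j` (age `0`) and slot `1` at
comparison `j + 1` (age `1`). [folklore] -/
theorem twoAge_populated : ∀ j : ℕ, ∀ a ≤ 1, ∃ s ∈ (Finset.univ : Finset (Fin 2)), j + a - (s : ℕ) = j := by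
  intro j a ha
  interval_cases a
  · exact ⟨0, Finset.mem_univ _, by simp⟩
  · exact ⟨1, Finset.mem_univ _, by simp⟩

/-- **THE THRESHOLDS OF THIS FAMILY ARE NOT EXPRESSIBLE BY ONE LEVEL SEQUENCE** (`…Sync` §0 applied): no
`θ' : ℕ → ℝ` satisfies `θ' (lvl K s) = ε (K − lvl K s)` on the live slots — END-I's level-indexed typing
(`ShellMeasureRootComposition.shellWeightBound_of_slotAC`) cannot be STATED for it with the true thresholds, whereas
the slot-indexed END-I fires on it (§3). [folklore] -/
theorem twoAge_not_levelIndexed :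
    ¬ ∃ θ' : ℕ → ℝ, ∀ K, ∀ s ∈ (Finset.univ : Finset (Fin 2)),
      θ' (K - (s : ℕ)) = 1 / (((K - (K - (s : ℕ)) : ℕ) : ℝ) + 1) := by
  rintro ⟨θ', h⟩
  have key := ageSync_eq_of_levelIndexed (S := fun _ : ℕ => (Finset.univ : Finset (Fin 2)))
    (lvl := fun K (s : Fin 2) => K - (s : ℕ)) (f := fun n : ℕ => 1 / ((n : ℝ) + 1)) h
    (twoAge_populated 0 0 zero_le_one) (twoAge_populated 0 1 le_rfl)
  norm_num at key

end Family

/-! ## §3 The slot-indexed END-I fires on the family, with live shells -/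

section Fires
variable {ϑ : ℝ}

/-- the threshold of slot `s` of comparison `K` (age `K − (K − s)`) lies in `(0, 1]`. [folklore] -/
theorem thr_mem (K : ℕ) (s : Fin 2) :
    0 < 1 / ((((K - (K - (s : ℕ))) : ℕ) : ℝ) + 1) ∧ 1 / ((((K - (K - (s : ℕ))) : ℕ) : ℝ) + 1) ≤ 1 := by
  refine ⟨by positivity, ?_⟩
  have h : (0 : ℝ) ≤ (((K - (K - (s : ℕ))) : ℕ) : ℝ) := Nat.cast_nonneg _
  rw [div_le_one (by positivity)]
  linarith

/-- **THE SHELL PART OF EVERY TERM IS LIVE** (`0 < ϑ`): `Σ_s θ_{K,s}·ϑ^{lvl}/4 > 0`. [folklore] -/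
theorem twoAge_sh_pos (hϑ0 : 0 < ϑ) (K : ℕ) :
    0 < ∑ s : Fin 2, 1 / ((((K - (K - (s : ℕ))) : ℕ) : ℝ) + 1) * (ϑ ^ (K - (s : ℕ)) / 4) :=
  Finset.sum_pos (fun s _ => mul_pos (thr_mem K s).1 (by positivity)) Finset.univ_nonempty

/-- the shell part is at most `1/2 ≤` the term weight `1` (`0 ≤ ϑ ≤ 1`). [folklore] -/
theorem twoAge_sh_le (hϑ0 : 0 ≤ ϑ) (hϑ1 : ϑ ≤ 1) (K : ℕ) :
    ∑ s : Fin 2, 1 / ((((K - (K - (s : ℕ))) : ℕ) : ℝ) + 1) * (ϑ ^ (K - (s : ℕ)) / 4) ≤ 1 := by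
  calc ∑ s : Fin 2, 1 / ((((K - (K - (s : ℕ))) : ℕ) : ℝ) + 1) * (ϑ ^ (K - (s : ℕ)) / 4)
      ≤ ∑ _s : Fin 2, (1 : ℝ) * (1 / 4) := Finset.sum_le_sum fun s _ =>
        mul_le_mul (thr_mem K s).2 (by linarith [pow_le_one₀ hϑ0 hϑ1 (n := K - (s : ℕ))])
          (by positivity) zero_le_one
    _ ≤ 1 := by norm_num

/-- **THE SLOT-INDEXED END-I FIRES ON THE TWO-AGE FAMILY.**  Both runs = the family above (terms `T K = {()}` of
weight `1`, shell part = the sum of the two pieces, slots `Fin 2` at levels `K − s`, uniform laws, identity variables,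
thresholds BY AGE `1/(age+1)`, widths `ϑ^j/4`, `D ≡ 1`, `M ≡ 1`), every binder of
`ShellMeasureRootCompositionSync.shellWeightBound_of_slotAC_sync` DISCHARGED (pushes with equality, (M1) by §1, (W1)
with `N₁ = 1`, `ν̄ = 2`, `D̄ = 1`, rate `c₁ = 1/4`), for `0 < ϑ < 1`.  Conclusion: END-I's literal `ShellWeightBound`
with `Wsh K = 2·Σ_s 1·ϑ^{K−s}/4`. [folklore] -/
theorem twoAge_shellWeightBound (hϑ0 : 0 < ϑ) (hϑ1 : ϑ < 1) :
    ShellWeightBound 0 (fun _ : ℕ => ({()} : Finset Unit)) (fun _ _ _ => (1 : ℝ)) (fun _ _ _ => (1 : ℝ))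
      (fun K _ _ => ∑ s : Fin 2, 1 / ((((K - (K - (s : ℕ))) : ℕ) : ℝ) + 1) * (ϑ ^ (K - (s : ℕ)) / 4))
      (fun K _ _ => ∑ s : Fin 2, 1 / ((((K - (K - (s : ℕ))) : ℕ) : ℝ) + 1) * (ϑ ^ (K - (s : ℕ)) / 4))
      (fun K => ∑ s ∈ (Finset.univ : Finset (Fin 2)), (1 : ℝ) * (ϑ ^ (K - (s : ℕ)) / 4) +
        ∑ s ∈ (Finset.univ : Finset (Fin 2)), (1 : ℝ) * (ϑ ^ (K - (s : ℕ)) / 4)) := by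
  haveI : IsFiniteMeasure (volume.restrict (Icc (0 : ℝ) 1)) := by
    refine ⟨?_⟩; rw [unif_univ]; exact ENNReal.one_lt_top
  have hρ1 : ∀ j : ℕ, ϑ ^ j / 4 ≤ 1 := fun j => by
    have := pow_le_one₀ hϑ0.le hϑ1.le (n := j); linarith
  -- the per-run binders (both runs identical)
  have sh_nonneg : ∀ (K : ℕ) (t : ℝ), |t| ≤ 0 → ∀ τ ∈ ({()} : Finset Unit),
      (0 : ℝ) ≤ ∑ s : Fin 2, 1 / ((((K - (K - (s : ℕ))) : ℕ) : ℝ) + 1) * (ϑ ^ (K - (s : ℕ)) / 4) :=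
    fun K _ _ _ _ => (twoAge_sh_pos hϑ0 K).le
  have sh_le : ∀ (K : ℕ) (t : ℝ), |t| ≤ 0 → ∀ τ ∈ ({()} : Finset Unit),
      ∑ s : Fin 2, 1 / ((((K - (K - (s : ℕ))) : ℕ) : ℝ) + 1) * (ϑ ^ (K - (s : ℕ)) / 4) ≤ (1 : ℝ) :=
    fun K _ _ _ _ => twoAge_sh_le hϑ0.le hϑ1.le K
  have cover : ∀ (K : ℕ) (t : ℝ), |t| ≤ 0 → ∀ τ ∈ ({()} : Finset Unit),
      ∑ s : Fin 2, 1 / ((((K - (K - (s : ℕ))) : ℕ) : ℝ) + 1) * (ϑ ^ (K - (s : ℕ)) / 4) ≤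
        ∑ s ∈ (Finset.univ : Finset (Fin 2)),
          (fun (K : ℕ) (_ : ℝ) (s : Fin 2) (_ : Unit) =>
            1 / ((((K - (K - (s : ℕ))) : ℕ) : ℝ) + 1) * (ϑ ^ (K - (s : ℕ)) / 4)) K t s τ :=
    fun _ _ _ _ _ => le_rfl
  have hM : ∀ (K : ℕ) (t : ℝ), |t| ≤ 0 → ∀ s ∈ (Finset.univ : Finset (Fin 2)), (0 : ℝ) ≤ 1 :=
    fun _ _ _ _ _ => zero_le_one
  have piece_le : ∀ (K : ℕ) (t : ℝ), |t| ≤ 0 → ∀ s ∈ (Finset.univ : Finset (Fin 2)),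
      ∑ _τ ∈ ({()} : Finset Unit), 1 / ((((K - (K - (s : ℕ))) : ℕ) : ℝ) + 1) * (ϑ ^ (K - (s : ℕ)) / 4) ≤
        1 * ((volume.restrict (Icc (0 : ℝ) 1)) {x : ℝ | 1 / ((((K - (K - (s : ℕ))) : ℕ) : ℝ) + 1) *
          (1 - ϑ ^ (K - (s : ℕ)) / 4) ≤ x ∧ x < 1 / ((((K - (K - (s : ℕ))) : ℕ) : ℝ) + 1)}).toReal := by
    intro K t _ s _
    rw [Finset.sum_singleton, unif_shell (thr_mem K s).1.le (thr_mem K s).2 (hρ1 _),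
      ENNReal.toReal_ofReal (mul_nonneg (thr_mem K s).1.le (by positivity)), one_mul]
  have total_ge : ∀ (K : ℕ) (t : ℝ), |t| ≤ 0 → ∀ s ∈ (Finset.univ : Finset (Fin 2)),
      1 * ((volume.restrict (Icc (0 : ℝ) 1)) (Set.univ : Set ℝ)).toReal ≤ ∑ _τ ∈ ({()} : Finset Unit), (1 : ℝ) :=
    fun _ _ _ _ _ => by rw [unif_univ, Finset.sum_singleton]; simp
  have hD0 : ∀ j : ℕ, (0 : ℝ) ≤ (fun _ : ℕ => (1 : ℝ)) j := fun _ => zero_le_one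
  have hρ0 : ∀ j : ℕ, (0 : ℝ) ≤ ϑ ^ j / 4 := fun _ => by positivity
  have hac : ∀ (K : ℕ) (t : ℝ), |t| ≤ 0 → ∀ s ∈ (Finset.univ : Finset (Fin 2)),
      SlotAntiConcentration (volume.restrict (Icc (0 : ℝ) 1)) (fun x : ℝ => x)
        (1 / ((((K - (K - (s : ℕ))) : ℕ) : ℝ) + 1)) (ϑ ^ (K - (s : ℕ)) / 4) ((fun _ : ℕ => (1 : ℝ)) (K - (s : ℕ))) :=
    fun K _ _ s _ => slotAC_unif (thr_mem K s).1.le (thr_mem K s).2 (by positivity) (hρ1 _)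
  have hD : ∀ j : ℕ, (fun _ : ℕ => (1 : ℝ)) j ≤ 1 := fun _ => le_rfl
  have hrate : ∀ j : ℕ, ϑ ^ j / 4 ≤ 1 / 4 * ϑ ^ j := fun j => by rw [div_eq_mul_inv, mul_comm]; norm_num
  exact shellWeightBound_of_slotAC_sync (ΩA := fun _ _ => ℝ) (ΩB := fun _ _ => ℝ)
    (μA := fun _ _ _ => volume.restrict (Icc (0 : ℝ) 1)) (μB := fun _ _ _ => volume.restrict (Icc (0 : ℝ) 1))
    (uA := fun _ _ _ x => x) (uB := fun _ _ _ x => x)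
    (θA := fun K (s : Fin 2) => 1 / ((((K - (K - (s : ℕ))) : ℕ) : ℝ) + 1))
    (θB := fun K (s : Fin 2) => 1 / ((((K - (K - (s : ℕ))) : ℕ) : ℝ) + 1))
    (lvlA := fun K (s : Fin 2) => K - (s : ℕ)) (lvlB := fun K (s : Fin 2) => K - (s : ℕ))
    (DA := fun _ => 1) (DB := fun _ => 1) (ρA := fun j => ϑ ^ j / 4) (ρB := fun j => ϑ ^ j / 4)
    (MA := fun _ _ _ => 1) (MB := fun _ _ _ => 1)
    sh_nonneg sh_le cover hM piece_le total_ge hD0 hρ0 hac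
    sh_nonneg sh_le cover hM piece_le total_ge hD0 hρ0 hac
    twoAge_liveWindow twoAge_liveWindow hϑ0 hϑ1 hD hD hrate hrate

/-- … and its shell weight is STRICTLY POSITIVE at every `K` — a genuine (non-degenerate) instance. [folklore] -/
theorem twoAge_weight_pos (hϑ0 : 0 < ϑ) (K : ℕ) :
    0 < ∑ s ∈ (Finset.univ : Finset (Fin 2)), (1 : ℝ) * (ϑ ^ (K - (s : ℕ)) / 4) +
      ∑ s ∈ (Finset.univ : Finset (Fin 2)), (1 : ℝ) * (ϑ ^ (K - (s : ℕ)) / 4) := by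
  have h : 0 < ∑ s ∈ (Finset.univ : Finset (Fin 2)), (1 : ℝ) * (ϑ ^ (K - (s : ℕ)) / 4) :=
    Finset.sum_pos (fun s _ => by positivity) Finset.univ_nonempty
  linarith

end Fires

end Summit.QuantumFields.BalabanUV.T4Continuum.ShellMeasureRootCompositionSyncToy

end
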